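import Mathlib.RingTheory.Kaehler.JacobiZariski
import Mathlib.RingTheory.Etale.Kaehler
import Mathlib.RingTheory.Smooth.Kaehler
import Mathlib.RingTheory.Etale.Basic
import Mathlib.RingTheory.RingHom.Etale
import Mathlib.RingTheory.Kaehler.Polynomial
import Mathlib.RingTheory.FinitePresentation
import Mathlib.Algebra.CharP.Defs
import HarnessLib

/-!
# Kedlaya's étale covers, algebraic core: the differential criterion for étaleness over `𝔸ⁿ`

Topic `Literature/AlgebraicGeometry/Resolution`; theorem-only support for the discharge of
`Literature.AlgebraicGeometry.Resolution.Kedlaya2004_finite_etale_off_hyperplane`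
(`KedlayaEtaleCovers.lean`; K. S. Kedlaya, *More étale covers of affine spaces in positive
characteristic*, J. Algebraic Geom. 14 (2005), Thm. 1). The last paragraph of Kedlaya's proof reads:
"the differentials of the functions `s_1/s^m, …, s_n/s^m` at `y` are linearly independent. But after
multiplication by `(s^{rm}/t)^p`, these become precisely the differentials of the functions
`u_1/u_0, …, u_n/u_0`. Hence `f` is unramified at `y`. That is, `f` is étale …". This file supplies
the commutative algebra behind that sentence:

* `Kedlaya2004.formallyEtale_of_bijective_mapBaseChange` — for `k → R → A` with `A` formally smooth
  over `k`: if `A ⊗_R Ω_{R/k} → Ω_{A/k}` is bijective then `A` is formally étale over `R`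
  (Jacobi–Zariski sequence, Mathlib `Algebra.H1Cotangent.exact_map_δ`,
  `Algebra.H1Cotangent.exact_δ_mapBaseChange`, `KaehlerDifferential.exact_mapBaseChange_map`);
* `Kedlaya2004.ringHom_etale_of_basis` — a `k`-algebra map `θ : k[y_1, …, y_n] → A` (`A` formally
  smooth and of finite type over the noetherian `k`) is étale as soon as `dθ(y_1), …, dθ(y_n)` is a
  basis of `Ω_{A/k}`;
* `Kedlaya2004.exists_basis_kaehler_of_formallyEtale` — if `A` is formally étale over
  `k[x_1, …, x_n]` then `dx_1, …, dx_n` is a basis of `Ω_{A/k}` (Mathlib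
  `KaehlerDifferential.tensorKaehlerEquivOfFormallyEtale`), and `smooth_of_etale_mvPolynomial`;
* `Kedlaya2004.D_add_pow_char` — "adding a `p`-th power to a function does not change its
  differential": `d(a + c^p) = da` in characteristic `p`.

Everything is proved; theorem-only, no named facts.

## References

* K. S. Kedlaya, *More étale covers of affine spaces in positive characteristic*, J. Algebraic
  Geom. 14 (2005) 187–192, proof of Thm. 1. [Kedlaya2004]
* The Stacks project, Tag 00S2 (Jacobi–Zariski sequence), Tag 031J / 00UO (differential
  criteria). [StacksProject]
-/

noncomputable section

universe u

open KaehlerDifferential TensorProduct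

namespace Literature.AlgebraicGeometry.Resolution

namespace Kedlaya2004

/-! ### The Jacobi–Zariski argument -/

section JacobiZariski

variable (k R A : Type u) [CommRing k] [CommRing R] [CommRing A] [Algebra k R] [Algebra k A]
  [Algebra R A] [IsScalarTower k R A]

/-- If `H¹(L_{A/k}) = 0` and `A ⊗_R Ω_{R/k} → Ω_{A/k}` is injective then `H¹(L_{A/R}) = 0`
(Jacobi–Zariski: `H¹(L_{A/k}) → H¹(L_{A/R}) → A ⊗_R Ω_{R/k} → Ω_{A/k}` is exact, Stacks 00S2).
[cite: StacksProject, Tag 00S2] -/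
theorem subsingleton_h1Cotangent_of_injective_mapBaseChange
    [Subsingleton (Algebra.H1Cotangent k A)]
    (hinj : Function.Injective (KaehlerDifferential.mapBaseChange k R A)) :
    Subsingleton (Algebra.H1Cotangent R A) := by
  refine ⟨fun x y => ?_⟩
  have hδ : ∀ z : Algebra.H1Cotangent R A, z = 0 := fun z => by
    have h1 : KaehlerDifferential.mapBaseChange k R A (Algebra.H1Cotangent.δ k R A z) = 0 :=
      (Algebra.H1Cotangent.exact_δ_mapBaseChange k R A).apply_apply_eq_zero z
    have h2 : Algebra.H1Cotangent.δ k R A z = 0 := hinj (by rw [h1, map_zero])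
    obtain ⟨w, hw⟩ := ((Algebra.H1Cotangent.exact_map_δ k R A) z).mp h2
    rw [← hw, Subsingleton.elim w 0, map_zero]
  rw [hδ x, hδ y]

/-- If `A ⊗_R Ω_{R/k} → Ω_{A/k}` is surjective then `Ω_{A/R} = 0`
(`Ω_{A/R}` is the cokernel of that map, Stacks 00S2 / 02HQ). [cite: StacksProject, Tag 00S2] -/
theorem subsingleton_kaehlerDifferential_of_surjective_mapBaseChange
    (hsurj : Function.Surjective (KaehlerDifferential.mapBaseChange k R A)) :
    Subsingleton Ω[A⁄R] := by
  refine ⟨fun x y => ?_⟩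
  have hzero : ∀ z : Ω[A⁄R], z = 0 := fun z => by
    obtain ⟨w, rfl⟩ := KaehlerDifferential.map_surjective k R A z
    obtain ⟨v, rfl⟩ := hsurj w
    exact (KaehlerDifferential.exact_mapBaseChange_map k R A).apply_apply_eq_zero v
  rw [hzero x, hzero y]

/-- **Differential criterion for formal étaleness** (Stacks 00S2 with 031J): for `k → R → A` with
`A` formally smooth over `k`, if `A ⊗_R Ω_{R/k} → Ω_{A/k}` is bijective then `A` is formally étale
over `R` (`H¹(L_{A/R}) = 0` and `Ω_{A/R} = 0`). [cite: StacksProject, Tag 00S2] -/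
theorem formallyEtale_of_bijective_mapBaseChange [Algebra.FormallySmooth k A]
    (hbij : Function.Bijective (KaehlerDifferential.mapBaseChange k R A)) :
    Algebra.FormallyEtale R A := by
  haveI hH1 : Subsingleton (Algebra.H1Cotangent R A) :=
    subsingleton_h1Cotangent_of_injective_mapBaseChange k R A hbij.1
  haveI hΩ : Subsingleton Ω[A⁄R] :=
    subsingleton_kaehlerDifferential_of_surjective_mapBaseChange k R A hbij.2
  haveI : Module.Projective A Ω[A⁄R] := Module.Projective.of_free
  haveI : Algebra.FormallySmooth R A := ⟨inferInstance, hH1⟩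
  haveI : Algebra.FormallyUnramified R A := ⟨hΩ⟩
  exact Algebra.FormallyEtale.of_formallyUnramified_and_formallySmooth

/-- A linear map between the base change of a free module and a free module which carries a basis
onto a basis (same index type) is bijective. [folklore] -/
theorem mapBaseChange_bijective_of_basis {ι : Type*} (b : Module.Basis ι A Ω[A⁄k])
    (b' : Module.Basis ι R Ω[R⁄k])
    (h : ∀ i, KaehlerDifferential.mapBaseChange k R A (1 ⊗ₜ b' i) = b i) :
    Function.Bijective (KaehlerDifferential.mapBaseChange k R A) := by
  let bA : Module.Basis ι A (A ⊗[R] Ω[R⁄k]) := Algebra.TensorProduct.basis A b'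
  let e : (A ⊗[R] Ω[R⁄k]) ≃ₗ[A] Ω[A⁄k] := bA.equiv b (Equiv.refl ι)
  have he : (e : (A ⊗[R] Ω[R⁄k]) →ₗ[A] Ω[A⁄k]) = KaehlerDifferential.mapBaseChange k R A := by
    refine bA.ext fun i => ?_
    rw [LinearEquiv.coe_coe, Module.Basis.equiv_apply, Equiv.refl_apply]
    change b i = KaehlerDifferential.mapBaseChange k R A (Algebra.TensorProduct.basis A b' i)
    rw [Algebra.TensorProduct.basis_apply, h i]
  rw [← he]
  exact e.bijective

end JacobiZariski

/-! ### Étaleness of a map from a polynomial ring -/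

section Polynomial

variable {k A : Type u} [CommRing k] [CommRing A] [Algebra k A] {n : ℕ}

/-- **A `k`-algebra map `θ : k[y_1, …, y_n] → A` with `dθ(y_i)` a basis of `Ω_{A/k}` is étale**, for
`A` formally smooth and of finite type over the noetherian ring `k` (then `A` is of finite
presentation over `k[y]`, and formally étale by `formallyEtale_of_bijective_mapBaseChange`). This is
the step "the differentials of `u_1/u_0, …, u_n/u_0` are linearly independent, hence `f` is
unramified [and, `X` being smooth there, étale]" of Kedlaya's proof. [cite: Kedlaya2004, proof of Thm. 1] -/
theorem ringHom_etale_of_basis [IsNoetherianRing k] [Algebra.FormallySmooth k A]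
    [Algebra.FiniteType k A] (θ : MvPolynomial (Fin n) k →ₐ[k] A)
    (b : Module.Basis (Fin n) A Ω[A⁄k]) (hb : ∀ i, b i = D k A (θ (MvPolynomial.X i))) :
    θ.toRingHom.Etale := by
  letI : Algebra (MvPolynomial (Fin n) k) A := θ.toRingHom.toAlgebra
  haveI : IsScalarTower k (MvPolynomial (Fin n) k) A :=
    IsScalarTower.of_algebraMap_eq fun c => by
      change algebraMap k A c = θ (algebraMap k (MvPolynomial (Fin n) k) c)
      rw [AlgHom.commutes]
  have hbij : Function.Bijective (KaehlerDifferential.mapBaseChange k (MvPolynomial (Fin n) k) A) := by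
    refine mapBaseChange_bijective_of_basis k (MvPolynomial (Fin n) k) A b
      (KaehlerDifferential.mvPolynomialBasis k (Fin n)) fun i => ?_
    rw [KaehlerDifferential.mapBaseChange_tmul, one_smul, KaehlerDifferential.mvPolynomialBasis_apply,
      KaehlerDifferential.map_D, hb i]
    rfl
  haveI : Algebra.FormallyEtale (MvPolynomial (Fin n) k) A :=
    formallyEtale_of_bijective_mapBaseChange k (MvPolynomial (Fin n) k) A hbij
  haveI : Algebra.FiniteType (MvPolynomial (Fin n) k) A :=
    Algebra.FiniteType.of_restrictScalars_finiteType k (MvPolynomial (Fin n) k) A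
  haveI : Algebra.FinitePresentation (MvPolynomial (Fin n) k) A :=
    (Algebra.FinitePresentation.of_finiteType (R := MvPolynomial (Fin n) k) (A := A)).mp inferInstance
  change @Algebra.Etale (MvPolynomial (Fin n) k) A _ _ θ.toRingHom.toAlgebra
  exact Algebra.Etale.mk

/-- **Étale coordinates give a basis of differentials**: if `A` is formally étale over
`k[x_1, …, x_n]` then `dx_1, …, dx_n` is a basis of `Ω_{A/k}` (`Ω_{A/k} ≅ A ⊗ Ω_{k[x]/k}`,
Mathlib `KaehlerDifferential.tensorKaehlerEquivOfFormallyEtale`). [folklore] -/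
theorem exists_basis_kaehler_of_formallyEtale [Algebra (MvPolynomial (Fin n) k) A]
    [IsScalarTower k (MvPolynomial (Fin n) k) A] [Algebra.FormallyEtale (MvPolynomial (Fin n) k) A] :
    ∃ b : Module.Basis (Fin n) A Ω[A⁄k],
      ∀ i, b i = D k A (algebraMap (MvPolynomial (Fin n) k) A (MvPolynomial.X i)) := by
  refine ⟨(Algebra.TensorProduct.basis A (KaehlerDifferential.mvPolynomialBasis k (Fin n))).map
    (KaehlerDifferential.tensorKaehlerEquivOfFormallyEtale k (MvPolynomial (Fin n) k) A), fun i => ?_⟩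
  rw [Module.Basis.map_apply, Algebra.TensorProduct.basis_apply,
    KaehlerDifferential.tensorKaehlerEquivOfFormallyEtale_apply, KaehlerDifferential.mapBaseChange_tmul,
    one_smul, KaehlerDifferential.mvPolynomialBasis_apply, KaehlerDifferential.map_D]

/-- A `k`-algebra étale over a polynomial ring `k[x_1, …, x_n]` is smooth over `k`. [folklore] -/
theorem smooth_of_etale_mvPolynomial [Algebra (MvPolynomial (Fin n) k) A]
    [IsScalarTower k (MvPolynomial (Fin n) k) A] [Algebra.Etale (MvPolynomial (Fin n) k) A] :
    Algebra.Smooth k A :=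
  haveI : Algebra.Smooth k (MvPolynomial (Fin n) k) := ⟨inferInstance, inferInstance⟩
  Algebra.Smooth.comp k (MvPolynomial (Fin n) k) A

/-- In a free module with a basis, a basis vector is non-zero; hence `A` is non-trivial as soon as
some `d a` is a basis vector (used as: `a ≠ 0`). [folklore] -/
theorem ne_zero_of_D_eq_basis [Nontrivial A] {ι : Type*} (b : Module.Basis ι A Ω[A⁄k]) (i : ι)
    {a : A} (ha : D k A a = b i) : a ≠ 0 := by
  intro h
  apply b.ne_zero i
  rw [← ha, h, map_zero]

end Polynomial

/-! ### Adding a `p`-th power does not change the differential -/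

section CharP

variable {k A : Type*} [CommRing k] [CommRing A] [Algebra k A]

/-- **"Adding a `p`-th power to a function does not change its differential"** (Kedlaya 2004, §3,
first paragraph): in characteristic `p`, `d(a + c^p) = da`. [cite: Kedlaya2004, §3] -/
theorem D_add_pow_char (p : ℕ) [CharP A p] (a c : A) :
    D k A (a + c ^ p) = D k A a := by
  rw [map_add, Derivation.leibniz_pow, ← Nat.cast_smul_eq_nsmul A p, CharP.cast_eq_zero, zero_smul,
    add_zero]

end CharP

end Kedlaya2004

end Literature.AlgebraicGeometry.Resolution

end
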